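import Literature.MathematicalPhysics.QuantumFieldTheory.Borinsky2020.HeppSectorConvergence
import Mathlib.MeasureTheory.Function.L2Space
import HarnessLib

/-!
# The moments of a monomial weight against a monomial sector density are Hepp-sector monomial integrals,
# so Panzer's criterion decides them: the `p`-th moment is finite iff `p·S_k − (p−1)·T_k > 0` on every chain
# set — `S_k > 0` for the mean, `2S_k − T_k > 0` for Theorem 5's variance («square integrable») — PROVED

Companion of `Borinsky2020/HeppSectorConvergence.lean` (Panzer, AIHPD 10 (2023) 31, §2.2 p. 42: the Hepp-sector
integral of `∏_l a_l^{s_l−1}` over `{0 < a_0 ≤ ⋯ ≤ a_m ≤ 1}` "converges precisely when" every chain partial sum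
`S_k = Σ_{l≤k} s_l` is positive — `lintegral_heppCube_monomial_lt_top_iff`) and of
`Borinsky2020/TropicalSamplingEstimator.lean` (Borinsky 2020 Theorem 5: the i.i.d. mean needs the weight to be
«square integrable under the measure μ over the domain Γ»; its converse `Probability/HeavyTails/CentralLimitNecessity`).
When the sampling density on the sector is itself a monomial `∏_l a_l^{t_l−1}` (Borinsky's `μ^tr` on a cone,
Algorithm 3 / eq. (5.2); Volkov's Hepp-sector density, PRD 96 §III.B–C) and the integrand behaves like the monomial
`∏_l a_l^{s_l−1}`, the weight is `W = ∏_l a_l^{s_l−t_l}` and the `p`-th MOMENT of `W` against the density is the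
sector integral of ONE MORE MONOMIAL, with exponents `p(s_l − t_l) + t_l`; Panzer's sentence therefore decides it.
This file types that sentence-sized corollary, which is the per-sector arithmetic behind «an exponent table decides
square integrability».

Sources, VERBATIM. [cite: Panzer2022, §2.2 p. 42 (e-print `hepp.tex` l.476–491; sentence before Proposition 2.9)]:
"this evaluates to … ∏ ∫_0^1 y_k^{(Σ_{i=1}^k a_{σ(i)})−1−(D/2) loops(G^σ_k)} dy_k = 1/(sdc(G^σ_1)⋯sdc(G^σ_{N−1})). This
integral converges precisely when all real parts Re sdc(G^σ_1), …, Re sdc(G^σ_{N−1}) > 0 are positive."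
[cite: Borinsky2020, Theorem 5 (e-print `tropical.tex` l.349–355 = journal Thm 2.5)]: "var[G^{(N)}] = (1/N) var[f(x)]
where var[f(x)] = ∫_Γ |f(x) − E[f(x)]|² μ, provided that the integrals in the last two lines exist. … The condition
that the integral for the variance shall exist effectively restricts the set of functions f, which can be integrated
numerically, to the set of square integrable functions under the measure μ over the domain Γ."
[cite: Volkov2017, §III.A (e-print `amm4_mc_arxiv.tex` l.491–532)]: "V(f,g) = ∫_Ω f(x)²/g(x) dx − (∫_Ω f(x) dx)² …
3. V(f,g) is infinite. In this case, we will have unstable convergence that is slower than C/√N."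

WHAT IS TYPED (vocabulary of the companion: `heppCube m = {0 < a_0 ≤ ⋯ ≤ a_m ≤ 1}`, exponent vectors
`s t : Fin (m+1) → ℝ`, chain partial sums over `Finset.Iic k`; REAL exponents, real moment order `p`):
* `weightPow_mul_density_eq` — on the sector, `(∏ a_l^{s_l−t_l})^p · ∏ a_l^{t_l−1} = ∏ a_l^{(p(s_l−t_l)+t_l)−1}`;
* **`lintegral_heppCube_weightPow_mul_density_lt_top_iff`** — `∫⁻ (∏ a^{s−t})^p ∏ a^{t−1} < ∞ ↔ ∀ k,
  0 < Σ_{l≤k} (p(s_l−t_l) + t_l)`, i.e. `p·S_k − (p−1)·T_k > 0` (`…_iff'`);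
* `p = 1`: the MEAN (`lintegral_heppCube_weight_mul_density_lt_top_iff`: ↔ `S_k > 0`, Panzer's own case);
  `p = 2`: **THE VARIANCE INTEGRAL of Theorem 5 / `V(f,g)`'s first term** (`lintegral_heppCube_weightSq_mul_density_lt_top_iff`:
  ↔ `2S_k − T_k > 0`); and `two_mul_sub_pos_imp` (with a normalisable density, `T_k > 0`, the variance condition
  implies the mean condition);
* **`memLp_two_weight_sectorLaw_iff`** — for the sector law `dμ_t = ∏ a^{t−1} da` on `heppCube`, the weight
  `∏ a^{s−t}` is in `L²(μ_t)` iff `2S_k − T_k > 0` for every `k` («square integrable functions under the measure μ»).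
NOT typed: which exponent vectors `s`, `t` a GRAPH or a WORD produces (the tables of the track's T1 / E1 seats and
`HeppBound.lean`); weights that are not comparable to a monomial on the sector; the limit LAW when the criterion fails
(only «not square integrable», whence no `√N`-CLT by `CentralLimitNecessity`). (Filed by the pub-qed TROPICAL-track
literature seat trop-lit g32, SOURCES A48; VALUE-FREE — an equivalence about elementary integrals, nothing per graph or
word; statistical Monte-Carlo evidence elsewhere on the track is evidence with stated σ, not a kernel certificate;
no new-physics claim.)
-/

noncomputable section

namespace Literature.MathematicalPhysics.QuantumFieldTheory.Borinsky2020

open MeasureTheory Set Real Finset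
open scoped ENNReal

variable {m : ℕ}

/-! ## The moment integrand is one more monomial -/

/-- On the sector (all `a_l > 0`): `(∏_l a_l^{s_l−t_l})^p · ∏_l a_l^{t_l−1} = ∏_l a_l^{(p(s_l−t_l)+t_l)−1}` — the `p`-th moment of
the weight against the density is the sector integral of a monomial with exponent vector `p(s−t)+t`.
[cite: Panzer2022, §2.2 p. 42 (sentence before Proposition 2.9)] [cite: Volkov2017, §III.A (V(f,g) = ∫ f²/g − (∫f)²)] -/
theorem weightPow_mul_density_eq (s t : Fin (m + 1) → ℝ) (p : ℝ) {a : Fin (m + 1) → ℝ} (ha : ∀ l, 0 < a l) :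
    (∏ l, a l ^ (s l - t l)) ^ p * ∏ l, a l ^ (t l - 1) = ∏ l, a l ^ ((p * (s l - t l) + t l) - 1) := by
  rw [← Real.finsetProd_rpow _ _ (fun l _ => Real.rpow_nonneg (ha l).le _), ← Finset.prod_mul_distrib]
  refine Finset.prod_congr rfl fun l _ => ?_
  rw [← Real.rpow_mul (ha l).le, ← Real.rpow_add (ha l)]
  congr 1
  ring

/-- The moment integrand is nonnegative on the sector. Plumbing. [cite: Panzer2022, §2.2 p. 42] -/
theorem weightPow_mul_density_nonneg (s t : Fin (m + 1) → ℝ) (p : ℝ) {a : Fin (m + 1) → ℝ} (ha : ∀ l, 0 < a l) :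
    0 ≤ (∏ l, a l ^ (s l - t l)) ^ p * ∏ l, a l ^ (t l - 1) :=
  mul_nonneg (Real.rpow_nonneg (Finset.prod_nonneg fun l _ => Real.rpow_nonneg (ha l).le _) _)
    (Finset.prod_nonneg fun l _ => Real.rpow_nonneg (ha l).le _)

/-! ## Panzer's criterion decides every moment -/

/-- **The `p`-th moment of the weight `∏ a^{s−t}` against the sector density `∏ a^{t−1}` is finite iff every chain partial
sum of the exponent vector `p(s−t)+t` is positive.** (Panzer's «converges precisely when», applied to that monomial.)
[cite: Panzer2022, §2.2 p. 42 (sentence before Proposition 2.9); Proposition 2.9] -/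
theorem lintegral_heppCube_weightPow_mul_density_lt_top_iff (s t : Fin (m + 1) → ℝ) (p : ℝ) :
    ∫⁻ a in heppCube m, ENNReal.ofReal ((∏ l, a l ^ (s l - t l)) ^ p * ∏ l, a l ^ (t l - 1)) < ∞ ↔
      ∀ k : Fin (m + 1), 0 < ∑ l ∈ Finset.Iic k, (p * (s l - t l) + t l) := by
  have hcongr : ∀ a ∈ heppCube m,
      ENNReal.ofReal ((∏ l, a l ^ (s l - t l)) ^ p * ∏ l, a l ^ (t l - 1))
        = ENNReal.ofReal (∏ l, a l ^ ((p * (s l - t l) + t l) - 1)) := fun a ha => by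
    rw [weightPow_mul_density_eq s t p ha.1.1]
  rw [setLIntegral_congr_fun measurableSet_heppCube hcongr]
  exact lintegral_heppCube_monomial_lt_top_iff (fun l => p * (s l - t l) + t l)

/-- The same with the partial sums split: `Σ_{l≤k} (p(s_l−t_l)+t_l) = p·S_k − (p−1)·T_k`, `S_k = Σ_{l≤k} s_l`, `T_k = Σ_{l≤k} t_l`.
[cite: Panzer2022, §2.2 p. 42 (sentence before Proposition 2.9)] -/
theorem lintegral_heppCube_weightPow_mul_density_lt_top_iff' (s t : Fin (m + 1) → ℝ) (p : ℝ) :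
    ∫⁻ a in heppCube m, ENNReal.ofReal ((∏ l, a l ^ (s l - t l)) ^ p * ∏ l, a l ^ (t l - 1)) < ∞ ↔
      ∀ k : Fin (m + 1), 0 < p * (∑ l ∈ Finset.Iic k, s l) - (p - 1) * ∑ l ∈ Finset.Iic k, t l := by
  rw [lintegral_heppCube_weightPow_mul_density_lt_top_iff]
  refine forall_congr' fun k => ?_
  have : ∑ l ∈ Finset.Iic k, (p * (s l - t l) + t l)
      = p * (∑ l ∈ Finset.Iic k, s l) - (p - 1) * ∑ l ∈ Finset.Iic k, t l := by
    rw [Finset.mul_sum, Finset.mul_sum, ← Finset.sum_sub_distrib]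
    exact Finset.sum_congr rfl fun l _ => by ring
  rw [this]

/-- **`p = 1`, THE MEAN**: `∫ W · density = ∫ ∏ a^{s−1}` is finite iff `S_k > 0` for every `k` — Panzer's criterion itself (the
unbiased value `I` of Theorem 5 / Proposition 20 exists). [cite: Panzer2022, §2.2 p. 42 (sentence before Proposition 2.9)]
[cite: Borinsky2020, Theorem 5 (tropical.tex l.349–355) "E[G^{(N)}] = E[f(x)] = ∫_Γ f(x) μ … provided that the integrals … exist"] -/
theorem lintegral_heppCube_weight_mul_density_lt_top_iff (s t : Fin (m + 1) → ℝ) :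
    ∫⁻ a in heppCube m, ENNReal.ofReal ((∏ l, a l ^ (s l - t l)) ^ (1 : ℝ) * ∏ l, a l ^ (t l - 1)) < ∞ ↔
      ∀ k : Fin (m + 1), 0 < ∑ l ∈ Finset.Iic k, s l := by
  rw [lintegral_heppCube_weightPow_mul_density_lt_top_iff']
  refine forall_congr' fun k => ?_
  rw [one_mul, sub_self, zero_mul, sub_zero]

/-- **`p = 2`, THE VARIANCE INTEGRAL** («square integrable functions under the measure μ»; `V(f,g)`'s `∫ f²/g`):
`∫ W² · density < ∞` iff **`2·S_k − T_k > 0` for every chain set** — the per-sector arithmetic behind «an exponent table decides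
the finiteness of the variance». [cite: Borinsky2020, Theorem 5 (tropical.tex l.355) "the set of square integrable functions under the measure μ"]
[cite: Volkov2017, §III.A case 3 "V(f,g) is infinite … unstable convergence that is slower than C/√N"]
[cite: Panzer2022, §2.2 p. 42 (sentence before Proposition 2.9)] -/
theorem lintegral_heppCube_weightSq_mul_density_lt_top_iff (s t : Fin (m + 1) → ℝ) :
    ∫⁻ a in heppCube m, ENNReal.ofReal ((∏ l, a l ^ (s l - t l)) ^ (2 : ℝ) * ∏ l, a l ^ (t l - 1)) < ∞ ↔
      ∀ k : Fin (m + 1), 0 < 2 * (∑ l ∈ Finset.Iic k, s l) - ∑ l ∈ Finset.Iic k, t l := by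
  rw [lintegral_heppCube_weightPow_mul_density_lt_top_iff']
  refine forall_congr' fun k => ?_
  norm_num

/-- With a NORMALISABLE density (`T_k > 0`, so that `∏ a^{t−1}` has finite mass on the sector by Panzer's criterion), the variance
condition `2S_k − T_k > 0` implies the mean condition `S_k > 0`: a square-integrable weight is integrable. Elementary.
[cite: Borinsky2020, Theorem 5 (tropical.tex l.349–355)] -/
theorem two_mul_sub_pos_imp {S T : ℝ} (hT : 0 < T) (h : 0 < 2 * S - T) : 0 < S := by linarith

/-- Conversely the variance condition can FAIL while the mean condition holds: `S_k > 0` but `2S_k ≤ T_k` on some chain set —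
an integrable weight of infinite variance on that sector (Volkov's case 3). Stated as the negation of the criterion.
[cite: Volkov2017, §III.A cases 2–3] [cite: Panzer2022, §2.2 p. 42] -/
theorem lintegral_heppCube_weightSq_mul_density_eq_top_of_le (s t : Fin (m + 1) → ℝ) {k : Fin (m + 1)}
    (hk : 2 * (∑ l ∈ Finset.Iic k, s l) - ∑ l ∈ Finset.Iic k, t l ≤ 0) :
    ∫⁻ a in heppCube m, ENNReal.ofReal ((∏ l, a l ^ (s l - t l)) ^ (2 : ℝ) * ∏ l, a l ^ (t l - 1)) = ∞ := by
  by_contra h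
  have hlt := (lintegral_heppCube_weightSq_mul_density_lt_top_iff s t).1 (lt_top_iff_ne_top.2 h) k
  linarith

/-! ## «Square integrable under the measure μ»: the `L²` form for the sector law -/

/-- The weight is measurable. Plumbing. [cite: Borinsky2020, Theorem 5 (tropical.tex l.349–355)] -/
theorem measurable_sectorWeight (s t : Fin (m + 1) → ℝ) :
    Measurable fun a : Fin (m + 1) → ℝ => ∏ l, a l ^ (s l - t l) :=
  Finset.measurable_prod _ fun l _ => (measurable_pi_apply l).pow_const _

/-- The density is measurable (as an `ℝ≥0∞`-valued function). Plumbing. [cite: Panzer2022, §2.2 p. 42] -/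
theorem measurable_sectorDensity (t : Fin (m + 1) → ℝ) :
    Measurable fun a : Fin (m + 1) → ℝ => ENNReal.ofReal (∏ l, a l ^ (t l - 1)) :=
  (Finset.measurable_prod _ fun l _ => (measurable_pi_apply l).pow_const _).ennreal_ofReal

/-- **Theorem 5's hypothesis, decided by the exponent table**: for the sector law `dμ_t = ∏_l a_l^{t_l−1} da` on
`{0 < a_0 ≤ ⋯ ≤ a_m ≤ 1}` (Borinsky's `μ^tr` on one cone up to its normalisation; Volkov's sector density), the weight
`W = ∏_l a_l^{s_l−t_l}` is SQUARE INTEGRABLE, `W ∈ L²(μ_t)`, iff `2S_k − T_k > 0` for every chain set `k`.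
[cite: Borinsky2020, Theorem 5 (tropical.tex l.349–355) "square integrable functions under the measure μ over the domain Γ"]
[cite: Panzer2022, §2.2 p. 42 (sentence before Proposition 2.9)] [cite: Volkov2017, §III.A (13) and cases 1–3] -/
theorem memLp_two_weight_sectorLaw_iff (s t : Fin (m + 1) → ℝ) :
    MemLp (fun a : Fin (m + 1) → ℝ => ∏ l, a l ^ (s l - t l)) 2
        (((volume : Measure (Fin (m + 1) → ℝ)).restrict (heppCube m)).withDensity
          fun a => ENNReal.ofReal (∏ l, a l ^ (t l - 1))) ↔
      ∀ k : Fin (m + 1), 0 < 2 * (∑ l ∈ Finset.Iic k, s l) - ∑ l ∈ Finset.Iic k, t l := by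
  set μ := ((volume : Measure (Fin (m + 1) → ℝ)).restrict (heppCube m)).withDensity
    fun a => ENNReal.ofReal (∏ l, a l ^ (t l - 1)) with hμ
  have hW := measurable_sectorWeight (m := m) s t
  rw [memLp_two_iff_integrable_sq hW.aestronglyMeasurable, ← lintegral_heppCube_weightSq_mul_density_lt_top_iff]
  -- `Integrable (W²) μ ↔ ∫⁻ ofReal (W²) dμ < ∞ ↔ ∫⁻ density · ofReal (W²) < ∞`
  have hsq_meas : Measurable fun a : Fin (m + 1) → ℝ => (∏ l, a l ^ (s l - t l)) ^ 2 := hW.pow_const 2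
  have hnn : 0 ≤ᵐ[μ] fun a : Fin (m + 1) → ℝ => (∏ l, a l ^ (s l - t l)) ^ 2 := ae_of_all _ fun a => sq_nonneg _
  rw [Integrable, and_iff_right hsq_meas.aestronglyMeasurable, hasFiniteIntegral_iff_ofReal hnn, hμ,
    lintegral_withDensity_eq_lintegral_mul _ (measurable_sectorDensity t) hsq_meas.ennreal_ofReal]
  -- compare the two integrands on the sector
  have hcongr : ∀ a ∈ heppCube m,
      ((fun a : Fin (m + 1) → ℝ => ENNReal.ofReal (∏ l, a l ^ (t l - 1))) *
          fun a : Fin (m + 1) → ℝ => ENNReal.ofReal ((∏ l, a l ^ (s l - t l)) ^ 2)) a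
        = ENNReal.ofReal ((∏ l, a l ^ (s l - t l)) ^ (2 : ℝ) * ∏ l, a l ^ (t l - 1)) := by
    intro a ha
    have hd : 0 ≤ ∏ l, a l ^ (t l - 1) := Finset.prod_nonneg fun l _ => Real.rpow_nonneg (ha.1.1 l).le _
    rw [Pi.mul_apply, ← ENNReal.ofReal_mul hd, Real.rpow_two, mul_comm]
  rw [setLIntegral_congr_fun measurableSet_heppCube hcongr]

/-! ## Weights COMPARABLE to a monomial; finitely many sectors

(Appended by trop-lit g32, SOURCES A48.7.)  Borinsky's weight on a cone is not a monomial but is COMPARABLE to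
one: by Theorem 8 / Corollary 9 (journal Thm 3.3 / Cor. 3.4) the ratios `p/p^tr` are bounded above and below by
positive constants, so `R_{a/b} · (μ^tr-density)`-type weights are squeezed between constant multiples of a
monomial sector by sector; and `μ^tr` is a FINITE sum of cone laws (Theorem 19 / Algorithm 3, journal Thm 4.5 /
Alg. 3: `I = Σ_σ I_σ`).  Two elementary transfers make the criterion above usable in that setting. -/

/-- **Two-sided comparability transfers square integrability**: if `c₁ |M| ≤ |W| ≤ c₂ |M|` a.e. with `c₁ > 0`, then
`W ∈ L²(μ) ↔ M ∈ L²(μ)` (both directions of Mathlib's `MemLp.of_le_mul`).  With `M` a monomial and the bounds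
supplied by Borinsky's two-sided tropical bound, the exponent criterion decides `W`.
[cite: Borinsky2020, Theorem 8 / Corollary 9 (tropical.tex l.446–470) — the two-sided bounds `C₁ p^tr ≤ |p| ≤ C₂ p^tr`; Theorem 5 (l.355)] -/
theorem memLp_two_iff_of_abs_le_abs_le {α : Type*} [MeasurableSpace α] {μ : Measure α} {W M : α → ℝ}
    (hW : AEStronglyMeasurable W μ) (hM : AEStronglyMeasurable M μ) {c₁ c₂ : ℝ} (hc₁ : 0 < c₁)
    (hlo : ∀ᵐ x ∂μ, c₁ * |M x| ≤ |W x|) (hhi : ∀ᵐ x ∂μ, |W x| ≤ c₂ * |M x|) :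
    MemLp W 2 μ ↔ MemLp M 2 μ := by
  constructor
  · intro h
    refine h.of_le_mul hM (c := c₁⁻¹) ?_
    filter_upwards [hlo] with x hx
    rw [Real.norm_eq_abs, Real.norm_eq_abs, inv_mul_eq_div, le_div_iff₀ hc₁, mul_comm]
    exact hx
  · intro h
    refine h.of_le_mul hW (c := c₂) ?_
    filter_upwards [hhi] with x hx
    rw [Real.norm_eq_abs, Real.norm_eq_abs]
    exact hx

/-- **The criterion for a weight COMPARABLE to a monomial on the sector**: if `c₁ ∏ a^{s−t} ≤ |W| ≤ c₂ ∏ a^{s−t}`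
a.e. for the sector law `dμ_t = ∏ a^{t−1} da` (`c₁ > 0`), then `W ∈ L²(μ_t)` iff `2S_k − T_k > 0` on every chain set.
[cite: Borinsky2020, Theorem 5 (tropical.tex l.355); Corollary 9 (l.463–470)] [cite: Panzer2022, §2.2 p. 42 (sentence before Proposition 2.9)] -/
theorem memLp_two_sectorLaw_iff_of_comparable (s t : Fin (m + 1) → ℝ) {W : (Fin (m + 1) → ℝ) → ℝ}
    (hW : AEStronglyMeasurable W
      (((volume : Measure (Fin (m + 1) → ℝ)).restrict (heppCube m)).withDensity
        fun a => ENNReal.ofReal (∏ l, a l ^ (t l - 1))))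
    {c₁ c₂ : ℝ} (hc₁ : 0 < c₁)
    (hlo : ∀ᵐ a ∂(((volume : Measure (Fin (m + 1) → ℝ)).restrict (heppCube m)).withDensity
        fun a => ENNReal.ofReal (∏ l, a l ^ (t l - 1))), c₁ * |∏ l, a l ^ (s l - t l)| ≤ |W a|)
    (hhi : ∀ᵐ a ∂(((volume : Measure (Fin (m + 1) → ℝ)).restrict (heppCube m)).withDensity
        fun a => ENNReal.ofReal (∏ l, a l ^ (t l - 1))), |W a| ≤ c₂ * |∏ l, a l ^ (s l - t l)|) :
    MemLp W 2 (((volume : Measure (Fin (m + 1) → ℝ)).restrict (heppCube m)).withDensity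
        fun a => ENNReal.ofReal (∏ l, a l ^ (t l - 1))) ↔
      ∀ k : Fin (m + 1), 0 < 2 * (∑ l ∈ Finset.Iic k, s l) - ∑ l ∈ Finset.Iic k, t l :=
  (memLp_two_iff_of_abs_le_abs_le hW (measurable_sectorWeight s t).aestronglyMeasurable hc₁ hlo hhi).trans
    (memLp_two_weight_sectorLaw_iff s t)

/-- **Finitely many sectors**: a measurable weight is square integrable for a finite SUM of laws iff it is square
integrable for each of them — so for `μ^tr = Σ_σ μ_σ` (one law per cone / Hepp sector) the global «square
integrable under μ» of Theorem 5 is the conjunction of the per-sector criteria.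
[cite: Borinsky2020, Theorem 19 / Algorithm 3 (tropical.tex l.776–867, l.925–946) — `I = Σ_σ I_σ`, the cone-by-cone law; Theorem 5 (l.355)] -/
theorem memLp_two_finsetSum_measure_iff {α : Type*} [MeasurableSpace α] {ι : Type*} (S : Finset ι)
    (μ : ι → Measure α) {W : α → ℝ} (hW : Measurable W) :
    MemLp W 2 (∑ i ∈ S, μ i) ↔ ∀ i ∈ S, MemLp W 2 (μ i) := by
  rw [memLp_two_iff_integrable_sq hW.aestronglyMeasurable, integrable_finsetSum_measure]
  refine forall₂_congr fun i _ => ?_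
  rw [memLp_two_iff_integrable_sq hW.aestronglyMeasurable]

/-- … hence, when on each law of the finite family the weight's square integrability is decided by some
criterion `P i` (e.g. the chain-sum condition of `memLp_two_sectorLaw_iff_of_comparable` with that sector's
exponents), square integrability for the sum is decided by ALL of them: «the exponent table decides».
[cite: Borinsky2020, Theorem 5 (tropical.tex l.355); Theorem 19 / Algorithm 3 (l.776–867)] -/
theorem memLp_two_finsetSum_measure_iff_forall {α : Type*} [MeasurableSpace α] {ι : Type*} (S : Finset ι)
    (μ : ι → Measure α) {W : α → ℝ} (hW : Measurable W) {P : ι → Prop}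
    (hP : ∀ i ∈ S, (MemLp W 2 (μ i) ↔ P i)) :
    MemLp W 2 (∑ i ∈ S, μ i) ↔ ∀ i ∈ S, P i := by
  rw [memLp_two_finsetSum_measure_iff S μ hW]
  exact ⟨fun h i hi => (hP i hi).1 (h i hi), fun h i hi => (hP i hi).2 (h i hi)⟩

end Literature.MathematicalPhysics.QuantumFieldTheory.Borinsky2020

end
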